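import Mathlib
import Summits.CriticalPhenomena.CardyFormulaZ2.Theorems.CardyMagicRigidityDefs
import HarnessLib

/-!
# Admissibility of cloud densities: stub `stub_cloudAdmissibility` (S1a) of line
# `ring-cloud-tomography` for crux `NestingRigidity` (stmt-CriticalPhenomena-4835)

Route `CardyMagicRigidity` (sub-problem `CriticalPhenomena/CardyFormulaZ2`), crux
`Summit.CriticalPhenomena.CardyFormulaZ2.Theses.CardyMagicRigidity.NestingRigidity`.  We prove the
registered stub `stub_cloudAdmissibility : CloudAdmissibility` of the checked skeleton
`Cruxes/NestingRigidity/Lines/ring-cloud-tomography.lean`: the test density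
`f = Σ_i a_i ρ_{x_i,r_i} + Σ_k g_k σ_{c_k,L_k,M_k}` of an ADMISSIBLE cloud (positive radii, total
charge zero) is a route-admissible test function of the magic formulas, i.e.

* measurable — a finite sum of constants times indicators of an open ball / of an annulus
  `{L ≤ ‖z − c‖ < M} = B(c, M) ∖ B(c, L)`;
* bounded — `|f| ≤ Σ_i |a_i| (π r_i²)⁻¹ + Σ_k |g_k| |(π (M_k² − L_k²))⁻¹|`;
* supported in a ball — `f z = 0` for `‖z‖ > Σ_i (‖x_i‖ + r_i) + Σ_k (‖c_k‖ + M_k)` (a crude radius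
  dominating every `‖x_i‖ + r_i` and every `‖c_k‖ + M_k`, all summands being nonnegative);
* mean zero — `∫ ρ_{x,r} = 1` (`Complex.volume_ball`: `|B(x,r)| = π r²`) and `∫ σ_{c,L,M} = 1`
  (`|B(c,M) ∖ B(c,L)| = π (M² − L²)`), whence `∫ f = Σ_i a_i + Σ_k g_k = 0` by neutrality.

Elementary measure theory (Mathlib only); no cited facts.  The helper lemmas live in the
sub-namespace `CloudAdmissibility` to keep the line namespace free for the sibling stub files.
-/

noncomputable section

open MeasureTheory Set Filter Metric
open scoped Real Topology BigOperators

namespace Summit.CriticalPhenomena.CardyFormulaZ2.Cruxes.NestingRigidity.RingCloudTomography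

open Literature.Probability.RandomPlanarGeometry Literature.Probability.Percolation
  Literature.Probability.LatticeModels

namespace CloudAdmissibility

/-! ### The disc density `ρ_{x,r}` -/

/-- The disc density is measurable (constant times the indicator of an open ball). -/
theorem measurable_discDensity (x : ℂ) (r : ℝ) : Measurable (discDensity x r) :=
  measurable_const.indicator measurableSet_ball

/-- The disc density is bounded by its plateau value `(π r²)⁻¹` in absolute value. -/
theorem abs_discDensity_le (x : ℂ) (r : ℝ) (z : ℂ) : |discDensity x r z| ≤ |(π * r ^ 2)⁻¹| := by
  rw [← Real.norm_eq_abs, ← Real.norm_eq_abs]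
  exact norm_indicator_le_norm_self (s := ball x r) (fun _ : ℂ ↦ (π * r ^ 2)⁻¹) z

/-- The disc density vanishes off the open disc: `ρ_{x,r}(z) = 0` if `r ≤ ‖z − x‖`. -/
theorem discDensity_eq_zero {x : ℂ} {r : ℝ} {z : ℂ} (hz : r ≤ ‖z - x‖) :
    discDensity x r z = 0 := by
  unfold discDensity
  apply Set.indicator_of_notMem
  rw [Metric.mem_ball, dist_eq_norm, not_lt]
  exact hz

/-- The disc density is integrable (bounded, supported in a ball of finite area). -/
theorem integrable_discDensity (x : ℂ) (r : ℝ) : Integrable (discDensity x r) := by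
  unfold discDensity
  exact (integrableOn_const measure_ball_ne_top).integrable_indicator measurableSet_ball

/-- The disc density is a probability density: `∫ ρ_{x,r} = |B(x,r)| · (π r²)⁻¹ = 1` for `r > 0`
(`Complex.volume_ball`). -/
theorem integral_discDensity (x : ℂ) {r : ℝ} (hr : 0 < r) : ∫ z, discDensity x r z = 1 := by
  unfold discDensity
  rw [integral_indicator_const _ measurableSet_ball, measureReal_def, Complex.volume_ball,
    ENNReal.toReal_mul, ENNReal.toReal_pow, ENNReal.toReal_ofReal hr.le, ENNReal.coe_toReal,
    NNReal.coe_real_pi, smul_eq_mul, mul_comm (r ^ 2) π]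
  exact mul_inv_cancel₀ (by positivity)

/-! ### The ring density `σ_{c,L,M}` -/

/-- The annulus `L ≤ ‖z − c‖ < M` is the difference of two concentric open balls. -/
theorem annulus_eq (c : ℂ) (L M : ℝ) :
    {z : ℂ | L ≤ ‖z - c‖ ∧ ‖z - c‖ < M} = ball c M \ ball c L := by
  ext z
  simp only [mem_setOf_eq, Set.mem_sdiff, Metric.mem_ball, dist_eq_norm, not_lt]
  exact and_comm

/-- The annulus `L ≤ ‖z − c‖ < M` is a measurable set. -/
theorem measurableSet_annulus (c : ℂ) (L M : ℝ) :
    MeasurableSet {z : ℂ | L ≤ ‖z - c‖ ∧ ‖z - c‖ < M} := by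
  rw [annulus_eq]
  exact measurableSet_ball.diff measurableSet_ball

/-- The annulus has finite area. -/
theorem volume_annulus_ne_top (c : ℂ) (L M : ℝ) :
    volume {z : ℂ | L ≤ ‖z - c‖ ∧ ‖z - c‖ < M} ≠ ⊤ := by
  rw [annulus_eq]
  exact ((measure_mono Set.sdiff_subset).trans_lt measure_ball_lt_top).ne

/-- The area of the annulus `L ≤ ‖z − c‖ < M` is `π (M² − L²)` for `0 ≤ L ≤ M`. -/
theorem volume_real_annulus (c : ℂ) {L M : ℝ} (hL : 0 ≤ L) (hLM : L ≤ M) :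
    volume.real {z : ℂ | L ≤ ‖z - c‖ ∧ ‖z - c‖ < M} = π * (M ^ 2 - L ^ 2) := by
  rw [annulus_eq, measureReal_sdiff (ball_subset_ball hLM) measurableSet_ball measure_ball_ne_top,
    measureReal_def, measureReal_def, Complex.volume_ball, Complex.volume_ball, ENNReal.toReal_mul,
    ENNReal.toReal_mul, ENNReal.toReal_pow, ENNReal.toReal_pow, ENNReal.toReal_ofReal hL,
    ENNReal.toReal_ofReal (hL.trans hLM), ENNReal.coe_toReal, NNReal.coe_real_pi]
  ring

/-- The ring density is measurable (constant times the indicator of a measurable annulus). -/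
theorem measurable_annulusDensity (c : ℂ) (L M : ℝ) : Measurable (annulusDensity c L M) :=
  measurable_const.indicator (measurableSet_annulus c L M)

/-- The ring density is bounded by its plateau value `(π (M² − L²))⁻¹` in absolute value. -/
theorem abs_annulusDensity_le (c : ℂ) (L M : ℝ) (z : ℂ) :
    |annulusDensity c L M z| ≤ |(π * (M ^ 2 - L ^ 2))⁻¹| := by
  rw [← Real.norm_eq_abs, ← Real.norm_eq_abs]
  exact norm_indicator_le_norm_self (s := {z : ℂ | L ≤ ‖z - c‖ ∧ ‖z - c‖ < M})
    (fun _ : ℂ ↦ (π * (M ^ 2 - L ^ 2))⁻¹) z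

/-- The ring density vanishes outside the outer circle: `σ_{c,L,M}(z) = 0` if `M ≤ ‖z − c‖`. -/
theorem annulusDensity_eq_zero {c : ℂ} {L M : ℝ} {z : ℂ} (hz : M ≤ ‖z - c‖) :
    annulusDensity c L M z = 0 := by
  unfold annulusDensity
  exact Set.indicator_of_notMem (fun h ↦ (not_lt.mpr hz) h.2) _

/-- The ring density is integrable (bounded, supported in an annulus of finite area). -/
theorem integrable_annulusDensity (c : ℂ) (L M : ℝ) : Integrable (annulusDensity c L M) := by
  unfold annulusDensity
  exact (integrableOn_const (volume_annulus_ne_top c L M)).integrable_indicator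
    (measurableSet_annulus c L M)

/-- The ring density is a probability density: `∫ σ_{c,L,M} = π (M² − L²) · (π (M² − L²))⁻¹ = 1`
for `0 < L < M`. -/
theorem integral_annulusDensity (c : ℂ) {L M : ℝ} (hL : 0 < L) (hLM : L < M) :
    ∫ z, annulusDensity c L M z = 1 := by
  unfold annulusDensity
  rw [integral_indicator_const _ (measurableSet_annulus c L M), volume_real_annulus c hL.le hLM.le,
    smul_eq_mul]
  have : 0 < M ^ 2 - L ^ 2 := by nlinarith
  exact mul_inv_cancel₀ (by positivity)

/-! ### The cloud density -/

/-- The density of a cloud is measurable. -/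
theorem measurable_density (𝔠 : Cloud) : Measurable 𝔠.density := by
  unfold Cloud.density
  exact (Finset.measurable_sum _ fun i _ ↦ (measurable_discDensity _ _).const_mul _).add
    (Finset.measurable_sum _ fun k _ ↦ (measurable_annulusDensity _ _ _).const_mul _)

/-- The density of a cloud is bounded:
`|f| ≤ Σ_i |a_i| |(π r_i²)⁻¹| + Σ_k |g_k| |(π (M_k² − L_k²))⁻¹|`. -/
theorem abs_density_le (𝔠 : Cloud) (z : ℂ) :
    |𝔠.density z| ≤ ∑ i, |𝔠.a i| * |(π * 𝔠.r i ^ 2)⁻¹| +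
      ∑ k, |𝔠.g k| * |(π * (𝔠.M k ^ 2 - 𝔠.L k ^ 2))⁻¹| := by
  unfold Cloud.density
  refine (abs_add_le _ _).trans (add_le_add ?_ ?_)
  · refine (Finset.abs_sum_le_sum_abs _ _).trans (Finset.sum_le_sum fun i _ ↦ ?_)
    rw [abs_mul]
    exact mul_le_mul_of_nonneg_left (abs_discDensity_le _ _ _) (abs_nonneg _)
  · refine (Finset.abs_sum_le_sum_abs _ _).trans (Finset.sum_le_sum fun k _ ↦ ?_)
    rw [abs_mul]
    exact mul_le_mul_of_nonneg_left (abs_annulusDensity_le _ _ _ _) (abs_nonneg _)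

/-- The density of an admissible cloud vanishes outside the ball of radius
`Σ_i (‖x_i‖ + r_i) + Σ_k (‖c_k‖ + M_k)` (every carrier lies inside this ball). -/
theorem density_eq_zero (𝔠 : Cloud) (h𝔠 : 𝔠.Admissible) {z : ℂ}
    (hz : ∑ i, (‖𝔠.x i‖ + 𝔠.r i) + ∑ k, (‖𝔠.c k‖ + 𝔠.M k) < ‖z‖) : 𝔠.density z = 0 := by
  have hx : ∀ i, 0 ≤ ‖𝔠.x i‖ + 𝔠.r i := fun i ↦ add_nonneg (norm_nonneg _) (h𝔠.r_pos i).le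
  have hc : ∀ k, 0 ≤ ‖𝔠.c k‖ + 𝔠.M k := fun k ↦
    add_nonneg (norm_nonneg _) ((h𝔠.L_pos k).le.trans (h𝔠.L_lt_M k).le)
  have hsx : 0 ≤ ∑ i, (‖𝔠.x i‖ + 𝔠.r i) := Finset.sum_nonneg fun i _ ↦ hx i
  have hsc : 0 ≤ ∑ k, (‖𝔠.c k‖ + 𝔠.M k) := Finset.sum_nonneg fun k _ ↦ hc k
  have h1 : ∀ i, discDensity (𝔠.x i) (𝔠.r i) z = 0 := fun i ↦ by
    apply discDensity_eq_zero
    have hi : ‖𝔠.x i‖ + 𝔠.r i ≤ ∑ j, (‖𝔠.x j‖ + 𝔠.r j) :=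
      Finset.single_le_sum (f := fun j ↦ ‖𝔠.x j‖ + 𝔠.r j) (fun j _ ↦ hx j) (Finset.mem_univ i)
    have := norm_sub_norm_le z (𝔠.x i)
    linarith
  have h2 : ∀ k, annulusDensity (𝔠.c k) (𝔠.L k) (𝔠.M k) z = 0 := fun k ↦ by
    apply annulusDensity_eq_zero
    have hk : ‖𝔠.c k‖ + 𝔠.M k ≤ ∑ l, (‖𝔠.c l‖ + 𝔠.M l) :=
      Finset.single_le_sum (f := fun l ↦ ‖𝔠.c l‖ + 𝔠.M l) (fun l _ ↦ hc l) (Finset.mem_univ k)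
    have := norm_sub_norm_le z (𝔠.c k)
    linarith
  simp [Cloud.density, h1, h2]

/-- The density of an admissible cloud has mean zero: `∫ f = Σ_i a_i + Σ_k g_k = 0`. -/
theorem integral_density (𝔠 : Cloud) (h𝔠 : 𝔠.Admissible) : ∫ z, 𝔠.density z = 0 := by
  have h1 : ∀ i, Integrable (fun z ↦ 𝔠.a i * discDensity (𝔠.x i) (𝔠.r i) z) := fun i ↦
    (integrable_discDensity _ _).const_mul _
  have h2 : ∀ k, Integrable (fun z ↦ 𝔠.g k * annulusDensity (𝔠.c k) (𝔠.L k) (𝔠.M k) z) :=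
    fun k ↦ (integrable_annulusDensity _ _ _).const_mul _
  have h3 : ∀ i, ∫ z, 𝔠.a i * discDensity (𝔠.x i) (𝔠.r i) z = 𝔠.a i := fun i ↦ by
    rw [integral_const_mul, integral_discDensity _ (h𝔠.r_pos i), mul_one]
  have h4 : ∀ k, ∫ z, 𝔠.g k * annulusDensity (𝔠.c k) (𝔠.L k) (𝔠.M k) z = 𝔠.g k := fun k ↦ by
    rw [integral_const_mul, integral_annulusDensity _ (h𝔠.L_pos k) (h𝔠.L_lt_M k), mul_one]
  unfold Cloud.density
  rw [integral_add (integrable_finsetSum _ fun i _ ↦ h1 i) (integrable_finsetSum _ fun k _ ↦ h2 k),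
    integral_finsetSum _ fun i _ ↦ h1 i, integral_finsetSum _ fun k _ ↦ h2 k]
  simp only [h3, h4]
  exact h𝔠.neutral

end CloudAdmissibility

/-! ### The registered stub -/

/-- **S1a · CloudAdmissibility** (registered stub `stub_cloudAdmissibility` of line
`ring-cloud-tomography`, crux `NestingRigidity`, stmt-CriticalPhenomena-4835): the density of an
admissible cloud is a route-admissible test function — measurable, bounded, supported in a ball, and
of mean zero. -/
theorem stub_cloudAdmissibility : CloudAdmissibility := by
  intro 𝔠 h𝔠
  exact ⟨CloudAdmissibility.measurable_density 𝔠, ⟨_, CloudAdmissibility.abs_density_le 𝔠⟩,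
    ⟨_, fun _ hz ↦ CloudAdmissibility.density_eq_zero 𝔠 h𝔠 hz⟩,
    CloudAdmissibility.integral_density 𝔠 h𝔠⟩

end Summit.CriticalPhenomena.CardyFormulaZ2.Cruxes.NestingRigidity.RingCloudTomography

end
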